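import Mathlib

/-!
# B3Hilbert90 — the norm-one / conjugation-quotient step of T4-B3 §B2(d)(ii)–(iii), kernel form

Sub-claim B3 (pub-hodge-repro2, README §6.1(a)) uses, place by place, that every element `y` of
norm one for a quadratic extension with conjugation `c` is of the form `y = e / c e`
(Hilbert's Theorem 90 for cyclic extensions, Neukirch CFT II (2.3) — fact E7 of the section), and,
for the continuity of the descended character `ν̃`, the explicit local section `y ↦ 1 + y`
(`(1 + y) / c(1 + y) = y` for `y ≠ −1`) of §B2(d)(iii).  For elements of norm one under an
INVOLUTIVE automorphism the classical explicit proof needs no Galois theory at all, and this file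
records it for an arbitrary field `L` with an involutive ring automorphism `c ≠ id`:

* `div_conj_one_add` — the section formula: `y * c y = 1`, `y ≠ −1` ⟹ `(1 + y) / c (1 + y) = y`;
* `exists_ne_zero_conj_eq_neg` — a non-zero `e` with `c e = −e` (from `c ≠ id`, `c ∘ c = id`);
* `exists_div_conj_of_mul_conj_eq_one` — Hilbert 90 for norm-one elements:
  `y * c y = 1` ⟹ `∃ e ≠ 0, y = e / c e` (witness `1 + y` for `y ≠ −1`, the anti-invariant `e`
  for `y = −1`).

This covers the non-split nonarchimedean places (`E_v/F_v` a quadratic field extension, `c` the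
non-trivial automorphism), the global field `E/F`, and the archimedean places (`ℂ` with complex
conjugation) of §B2(d)(ii).  The split places (`E_v = F_v × F_v`, `c` = swap) are the
elementary `exists_mul_swap_inv_eq` for a product of two copies of a commutative group.

What stays prose: the unramified-units refinement (norm-one UNITS are quotients of UNITS,
Neukirch II (4.3) / Serre LCFT VI §1.2 Prop. 1 — facts E8/E31 of the section).
-/

namespace Summit.Ventures.HodgeRepro2.ShimuraData.B3Hilbert90

section Field

variable {L : Type*} [Field L]

/-- The explicit local section of §B2(d)(iii): if `y * c y = 1` and `y ≠ -1`, then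
`(1 + y) / c (1 + y) = y`. -/
theorem div_conj_one_add (c : L ≃+* L) {y : L} (hy : y * c y = 1) (hy1 : y ≠ -1) :
    (1 + y) / c (1 + y) = y := by
  have hy0 : y ≠ 0 := by
    rintro rfl
    simp at hy
  have hcy : c y = y⁻¹ := eq_inv_of_mul_eq_one_left (by rw [mul_comm]; exact hy)
  have h1y : 1 + y ≠ 0 := by
    intro h
    apply hy1
    linear_combination h
  have h1y' : 1 + y⁻¹ ≠ 0 := by
    intro h
    apply h1y
    have h' : (1 + y⁻¹) * y = 0 := by rw [h, zero_mul]
    rw [add_mul, one_mul, inv_mul_cancel₀ hy0] at h'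
    linear_combination h'
  rw [map_add, map_one, hcy, div_eq_iff h1y', mul_add, mul_one, mul_inv_cancel₀ hy0, add_comm]

/-- An involutive automorphism `c ≠ id` of a field has a non-zero anti-invariant element:
`e = a - c a` for any `a` with `c a ≠ a`. -/
theorem exists_ne_zero_conj_eq_neg (c : L ≃+* L) (hc : ∀ x, c (c x) = x)
    (hne : ∃ a : L, c a ≠ a) : ∃ e : L, e ≠ 0 ∧ c e = -e := by
  obtain ⟨a, ha⟩ := hne
  refine ⟨a - c a, sub_ne_zero.2 (Ne.symm ha), ?_⟩
  rw [map_sub, hc, neg_sub]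

/-- Hilbert's Theorem 90 for norm-one elements under an involutive automorphism `c ≠ id` of a
field (the case used in T4-B3 §B2(d)(ii) at the non-split nonarchimedean places, at the
archimedean places and globally): if `y * c y = 1` then `y = e / c e` for some `e ≠ 0`. -/
theorem exists_div_conj_of_mul_conj_eq_one (c : L ≃+* L) (hc : ∀ x, c (c x) = x)
    (hne : ∃ a : L, c a ≠ a) {y : L} (hy : y * c y = 1) :
    ∃ e : L, e ≠ 0 ∧ y = e / c e := by
  by_cases hy1 : y = -1
  · obtain ⟨e, he0, hce⟩ := exists_ne_zero_conj_eq_neg c hc hne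
    refine ⟨e, he0, ?_⟩
    rw [hce, div_neg, div_self he0, hy1]
  · refine ⟨1 + y, ?_, (div_conj_one_add c hy hy1).symm⟩
    intro h
    apply hy1
    linear_combination h

end Field

section Split

variable {G : Type*} [CommGroup G]

/-- The split place: in `G × G` with `c = swap`, every `y` with `y * swap y = 1` is
`x * (swap x)⁻¹` for `x = (y.1, 1)` (T4-B3 §B2(d)(ii), «at a split place
`E_v = F_v × F_v` with `c(a, b) = (b, a)`, `y_v = (a, a⁻¹) = j((a, 1))`»). -/
theorem exists_mul_swap_inv_eq (y : G × G) (hy : y * Prod.swap y = 1) :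
    ∃ x : G × G, y = x * (Prod.swap x)⁻¹ := by
  refine ⟨(y.1, 1), ?_⟩
  have h2 : y.2 = y.1⁻¹ := by
    have := congrArg Prod.snd hy
    simp only [Prod.snd_mul, Prod.snd_swap, Prod.snd_one] at this
    rw [eq_inv_iff_mul_eq_one]
    exact this
  ext
  · simp
  · simp [h2]

end Split

end Summit.Ventures.HodgeRepro2.ShimuraData.B3Hilbert90
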